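import Summits.CriticalPhenomena.PercolationContinuityZ3.Theorems.Transplant.FKConnectivityAllQTwoClusterAssoc
import Literature.Probability.Percolation.FoldingFibres
import HarnessLib

/-!
# The COEFFICIENTWISE (fibrewise) two-cluster conjectures `C22Pos`, `TwoClusterFibreAssocPos` (NOT asserted) and their kernel
# consequences `TwoClusterFourPointPos`, `TwoClusterAssocPos` via folding fibres

Support file (`--supports stmt-CriticalPhenomena-4575`), FK sub-lane `prim-bschramm-fk-1` (gen 13) of the post-continuity programme;
builds on p205010 (kernel theorem, internal audit signed; external expert review pending).  Definitions (two counting predicates and two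
`@[conjecture]` nodes — NOT asserted), no named facts, no sorries; standard axioms.

FOLDING FIBRES (`Literature/Probability/Percolation/FoldingFibres.lean`, van den Berg–Fiebig / Reimer / Linusson's Model `E₃`): for two
independent copies of `P_w` group the pairs `(ω, ω′)` by the disagreement set `M = ω ∆ ω′` and the common part `u = ω ∖ M`; on a fibre the
pair weight is constant and `P_w(A)·P_w(B) = Σ_{M,u} w(u)w(u ∆ M)·#{ω : ω ∖ M = u, ω ∈ A, ω ∆ M ∈ B}`, so a COUNTING inequality fibre by
fibre gives the product inequality for EVERY weight vector (`prodBernoulli_real_mul_le_of_fibrewise`) — "coefficientwise ⇒ numerically",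
the fibre counts being the Bernstein coefficients of the difference polynomial.

THIS FILE types the two fibrewise statements behind the two-cluster corner of the `q < 1` column and proves the reductions:
* `C22FibreOn V` — for every fibre `(M, u)` and all `o, a, c, b`: `#{ω : ω ∈ {oa|cb} ∩ L₂, ω ∆ M ∈ {oc|ab} ∩ L₂} ≤ #{ω : ω ∈ {oab|c} ∩ L₂,
  ω ∆ M ∈ {ocb|a} ∩ L₂}` (crossed ≤ aligned; `L₂` = exactly two clusters) — equivalently `T₃T₄ − T₆T₇ ∈ ℕ[x_e]` for the two-component
  pattern polynomials, the bottom `q`-grade of fk-1 g4's coefficientwise four-point conjecture; node `C22Pos`; **`twoClusterFourPointOn_of_c22`**,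
  **`twoClusterFourPointPos_of_c22Pos`** (kernel).
* `TwoClusterFibreAssocOn V` — for every fibre, all `a, c` and up-sets `𝒰, 𝒱`:
  `#{ω : ω ∈ {C_a ∈ 𝒰} ∩ E, ω ∆ M ∈ {C_a ∈ 𝒱} ∩ E} ≤ #{ω : ω ∈ {C_a ∈ 𝒰 ∩ 𝒱} ∩ E, ω ∆ M ∈ E}`, `E = {a ↮ c} ∩ L₂` (CW-CA₂); node
  `TwoClusterFibreAssocPos`; **`twoClusterAssocOn_of_fibreAssocOn`**, **`twoClusterAssocPos_of_fibreAssocPos`** (kernel; hence also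
  `TwoClusterFourPointPos` via `twoClusterFourPointPos_of_assocPos`).
EVIDENCE (fk-1 g13, exact counting, memo bschramm/FROM-fk-1-g13-TWO-CLUSTER.md §1): C22 0 / 5,133,012 fibre cells on all weighted graphs
with ≤ 6 vertices and 0 / 526,308,328 on 1,301 random graphs with 6–8 vertices (kit j135256); CW-CA₂ 0 / 21,484,332 resp.
0 / 8,049,479,306; fk-1 g4: the `q`-graded coefficientwise four-point inequality has 0 deficits through `K₇` (its bottom grade is C22).
What is FALSE at the fibre level (memo §3): a universal Ahlswede–Daykin injection `(S_R, S_B) ↦ (⊇ S_R ∪ S_B, ⊆ S_R ∩ S_B)` (Hall fails on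
the 4-cycle) and positive association of the `X/Y`-split law inside a `(P, Q)`-class; what holds in every tested fibre (n ≤ 7): a perfect
matching crossed → aligned changing only edges at `b`'s mixed component (memo §3b) — the shape a bijective proof should have.
[cite: Linusson2011, Prop. 2.6] [cite: VandenbergGandolfi2012, §3 Def. 12] [cite: KozmaNitzan2024, Thm. 1, eq. (6) (pp. 7–8)]
[cite: Grimmett2006, §1.2 eq. (1.1) (p. 4); §3.9 (pp. 63–65)]
-/

noncomputable section

namespace Summit.CriticalPhenomena.PercolationContinuityZ3.Theorems

namespace FK

open MeasureTheory Set Literature.Probability.LatticeModels Literature.Probability.Percolation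
open scoped Classical symmDiff

variable {V : Type*} [Fintype V]

/-! ### The fibre counts -/

/-- **Fibre count**: the number of configurations `ω` on the fibre `(M, u)` (`ω ∖ M = u`) with `ω ∈ A` and `ω ∆ M ∈ B` — the Bernstein
coefficient of `P_w(A)·P_w(B)` at the monomial indexed by `(M, u)`. [cite: Linusson2011, Prop. 2.6] [cite: VandenbergGandolfi2012, §3 Def. 12] -/
def fibreCount (M u : BondConfig V) (A B : Set (BondConfig V)) : ℕ :=
  (Finset.univ.filter fun ω : BondConfig V => ω \ M = u ∧ ω ∈ A ∧ ω ∆ M ∈ B).card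

/-! ### C22: crossed ≤ aligned, fibre by fibre -/

/-- **C22 on the vertex type `V`** (coefficientwise two-cluster four-point inequality): on every fibre `(M, u)` the number of pairs
(`ω ∈ {oa|cb} ∩ L₂`, `ω ∆ M ∈ {oc|ab} ∩ L₂`) ("crossed") is at most the number of pairs (`ω ∈ {oab|c} ∩ L₂`, `ω ∆ M ∈ {ocb|a} ∩ L₂`)
("aligned"). Equivalently the difference `T₃T₄ − T₆T₇` of products of two-component pattern polynomials has nonnegative coefficients.
[cite: KozmaNitzan2024, Thm. 1, eq. (6) (pp. 7–8)] [cite: Linusson2011, Prop. 2.6] -/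
def C22FibreOn (V : Type*) [Fintype V] : Prop :=
  ∀ (M u : BondConfig V), Disjoint u M → ∀ (o a c b : V),
    fibreCount M u (openConn o a ∩ openConn b c ∩ sepEv a c ∩ levelSet V 2) (openConn o c ∩ openConn b a ∩ sepEv a c ∩ levelSet V 2) ≤
      fibreCount M u (openConn o a ∩ openConn b a ∩ sepEv a c ∩ levelSet V 2) (openConn o c ∩ openConn b c ∩ sepEv a c ∩ levelSet V 2)

/-- **C22 on every finite vertex type.**  CONJECTURE-SHAPED COUNTING STATEMENT, NOT asserted.  Evidence (fk-1 g4, g13; exact): 0 deficits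
in all fibres of all graphs with ≤ 7 vertices (q-graded census of g4 through `K₇`; g13: 0 / 5.1·10⁶ + 0 / 5.3·10⁸ fibre cells on graphs with
≤ 8 vertices).  Implies `TwoClusterFourPointPos` (`twoClusterFourPointPos_of_c22Pos`). [cite: KozmaNitzan2024, Thm. 1 (p. 7)]
[cite: Linusson2011, Prop. 2.6] -/
@[conjecture] def C22Pos : Prop := ∀ n : ℕ, C22FibreOn (Fin n)

/-- **C22 ⇒ the two-cluster four-point inequality on `V`, for every weight vector** (folding fibres).
[cite: Linusson2011, Prop. 2.6] [cite: KozmaNitzan2024, Thm. 1, eq. (6) (pp. 7–8)] -/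
theorem twoClusterFourPointOn_of_c22 (h : C22FibreOn V) : TwoClusterFourPointOn V := by
  intro w o a c b
  exact prodBernoulli_real_mul_le_of_fibrewise w _ _ _ _ fun M u hd => h M u hd o a c b

/-- **`C22Pos → TwoClusterFourPointPos`.** [cite: Linusson2011, Prop. 2.6] [cite: KozmaNitzan2024, Thm. 1 (p. 7)] -/
theorem twoClusterFourPointPos_of_c22Pos (h : C22Pos) : TwoClusterFourPointPos := fun n => twoClusterFourPointOn_of_c22 (h n)

/-! ### CW-CA₂: coefficientwise positive association of the two-cluster law -/

/-- **Fibrewise positive association of `C_a` under the two-cluster law on `V`** (CW-CA₂): on every fibre `(M, u)`, for all `a, c` and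
up-sets `𝒰, 𝒱` of vertex sets, `#{ω ∈ {C_a ∈ 𝒰} ∩ E, ω ∆ M ∈ {C_a ∈ 𝒱} ∩ E} ≤ #{ω ∈ {C_a ∈ 𝒰 ∩ 𝒱} ∩ E, ω ∆ M ∈ E}`, `E = {a ↮ c} ∩ L₂`.
[cite: VandenbergHaggstromKahn2005, Thm. 1.5 (p. 7)] [cite: Linusson2011, Prop. 2.6] -/
def TwoClusterFibreAssocOn (V : Type*) [Fintype V] : Prop :=
  ∀ (M u : BondConfig V), Disjoint u M → ∀ (a c : V) (𝒰 𝒱 : Set (Set V)), IsUpperSet 𝒰 → IsUpperSet 𝒱 →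
    fibreCount M u (clusterIn a 𝒰 ∩ twoClusterEv a c) (clusterIn a 𝒱 ∩ twoClusterEv a c) ≤
      fibreCount M u (clusterIn a 𝒰 ∩ clusterIn a 𝒱 ∩ twoClusterEv a c) (twoClusterEv a c)

/-- **CW-CA₂ on every finite vertex type.**  CONJECTURE-SHAPED COUNTING STATEMENT, NOT asserted.  Evidence (fk-1 g13, exact): 0 / 2.1·10⁷
fibre × up-set-pair cells on all weighted graphs with ≤ 6 vertices (all pairs of up-sets), 0 / 8.0·10⁹ on 1,301 random graphs with 6–8 vertices
(principal/hitting up-sets and unions).  Implies `TwoClusterAssocPos` (`twoClusterAssocPos_of_fibreAssocPos`), hence `TwoClusterFourPointPos`.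
[cite: VandenbergHaggstromKahn2005, Thm. 1.5 (p. 7)] [cite: Linusson2011, Prop. 2.6] -/
@[conjecture] def TwoClusterFibreAssocPos : Prop := ∀ n : ℕ, TwoClusterFibreAssocOn (Fin n)

/-- **CW-CA₂ ⇒ CA₂ on `V`, for every weight vector** (folding fibres). [cite: Linusson2011, Prop. 2.6]
[cite: VandenbergHaggstromKahn2005, Thm. 1.5 (p. 7)] -/
theorem twoClusterAssocOn_of_fibreAssocOn (h : TwoClusterFibreAssocOn V) : TwoClusterAssocOn V := by
  intro w a c 𝒰 𝒱 h𝒰 h𝒱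
  exact prodBernoulli_real_mul_le_of_fibrewise w _ _ _ _ fun M u hd => h M u hd a c 𝒰 𝒱 h𝒰 h𝒱

/-- **`TwoClusterFibreAssocPos → TwoClusterAssocPos`.** [cite: Linusson2011, Prop. 2.6] [cite: VandenbergHaggstromKahn2005, Thm. 1.5 (p. 7)] -/
theorem twoClusterAssocPos_of_fibreAssocPos (h : TwoClusterFibreAssocPos) : TwoClusterAssocPos :=
  fun n => twoClusterAssocOn_of_fibreAssocOn (h n)

/-- **`TwoClusterFibreAssocPos → TwoClusterFourPointPos`** (through `TwoClusterAssocPos`). [cite: KozmaNitzan2024, Thm. 1 (p. 7)]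
[cite: Linusson2011, Prop. 2.6] -/
theorem twoClusterFourPointPos_of_fibreAssocPos (h : TwoClusterFibreAssocPos) : TwoClusterFourPointPos :=
  twoClusterFourPointPos_of_assocPos (twoClusterAssocPos_of_fibreAssocPos h)

end FK

end Summit.CriticalPhenomena.PercolationContinuityZ3.Theorems

end
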